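import Literature.MathematicalPhysics.QuantumFieldTheory.Balaban1983to89.B8Prop5KLevelLetters
import Literature.MathematicalPhysics.QuantumFieldTheory.Balaban1983to89.B8LanF146
import Literature.MathematicalPhysics.QuantumFieldTheory.Balaban1983to89.B8SockHFPAssembly

/-!
# `Balaban1983to89.B8SockSP5OfLettersSrc` — [Balaban1985RegularSpaces] Prop. 5 p. 94 ∕ Thm 8 (1.146) p. 101: THE SOURCED SOCKET ADAPTER —
# n04-b's `B8Prop5KLevelLetters.hP5_step_of_HFP` ∕ `hP5_of_HFP` (plain-currency fixed point ⇒ the Theorem-4 driver's socket shape) RE-RUN for the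
# SOURCED gauge condition: the fixed point's Landau clause is the MULTIPLIER FORM OF (1.146) (`… − f`) and the socket's gauge predicate is seat
# n05-c g5's `B8LanF146.LanF146` — the currency of the N05 knit's sourced socket `SP5` at `LanF := LanF146`

statement-level skeleton of published theorems with citation tags; proofs where landed; nothing here is a claim about the Yang–Mills mass gap

T. Bałaban, *Spaces of regular gauge field configurations on a lattice and gauge fixing conditions*, Commun. Math. Phys. **99** (1985) 75–102
`[Balaban1985RegularSpaces]` ("B8"): Prop. 5 (1.106)–(1.110) p. 94, (1.86)–(1.88) p. 91, (1.38) p. 82, Thm 8 (1.146) p. 101.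

## WHY THIS FILE (cell `pub-ymgap`, HUMAN RULING D-0062; R134 seat `pub-ymgap-dag-n05-d` g5, DAG node N05 = [B8]; count-neutral)

Ninth brick of the sourced Proposition-5 providers.  `B8SockHFPRDSrc.sockHFP_body_of_join_RD_src` (this seat, p505311) delivers, for the level-`m` datum, the fixed
point `λ` in PLAIN currency with the multiplier form of (1.146) at `m + 1` levels; the N05 knit's sourced socket `SP5` (text of seat n05-c g5's
`B8Thm8SurvivingZd3H.thm8SurvivingAt_zd3H_univ_lan`) wants instead a unitary gauge transformation `v` with `v = e^{iλ}` on the touched bonds, (1.108), and the GAUGE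
PREDICATE `LanF i U₀ φ (m + 1) (U₁^{v⁻¹})` — at the closer's instance `LanF := LanF146 L k η Ω₀ Λs U₀ f` (n05-c g5's `B8LanF146`: the multiplier form of (1.146) at
every level, plus `f ∈ R(U₀)` at the top).  THIS FILE is the adapter between the two, n04-b's `hP5_step_of_HFP`∕`hP5_of_HFP` VERBATIM with
`isLandau138W_gaugeFixed_of_multiplier` ↦ n05-c's `lanF146_gaugeFixed_of_multiplier` and the transport lemma `lanF146_congr` (locality of the clause in the
configuration, as `B8Eq138LandauZd.isLandau138W_congr`).

WHAT THIS FILE PROVES (kernel, 0 sorry, theorems only): `lanF146_congr`; ★ `hP5_step_of_HFP_src` (one level); ★ `hP5_of_HFP_src` (all levels `1 ≤ m < k`).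
NEXT (this lineage): `sp5_of_sockLettersRD_src` = `hP5_of_HFP_src ∘ sockHFP_body_of_join_RD_src` with the [4] letters, the sourced b9 lines `SH59src` and the windows
threaded (the `SP5` face at one law member), then the thresholds.

HONEST SCOPE.  Socket plumbing only; the fixed point is a hypothesis; count-neutral; N05 NOT discharged; one finite `T⁴` programme at fixed `ε`, Bałaban as printed —
nothing continuum ∕ ℝ⁴ ∕ OS ∕ mass-gap ∕ Clay.  No `sorry`, no definition.  Unit `pub-ymgap-dag-n05-d` (g5), 2026-08-27.

[cite: Balaban1985RegularSpaces, Prop. 5 (1.106)–(1.110) p.94, (1.86)–(1.88) p.91, (1.38) p.82, Thm 8 (1.146) p.101]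
-/

noncomputable section

open NormedSpace
open Complex (I I_ne_zero)

namespace Literature.MathematicalPhysics.QuantumFieldTheory.Balaban1983to89.B8SockSP5OfLettersSrc

open MatrixLog B7Prop1Explicit B7Prop2Explicit B7Eq92Concrete
open B7Eq78Linearization (conjR)
open B8Ineq132 (covDerivFwd covDeriv BondTouches)
open B8Eq182Proof (gAd)
open B8Eq184Proof (gaugeExp cfgExp)
open B8Eq188Proof (frakF3)
open B8Eq138LandauZd (covDivB covLap QT logCfg InR138 logCfg_congr)
open B8Eq140Level (SideTouches)
open B8Eq119TwistedAxial (Restr129)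
open B8LanF146 (LanF146 lanF146_gaugeFixed_of_multiplier)
open B8SockHFPAssembly (covDivB_congr_at)

-- `Site` alone could resolve to the torus sites of `Setup.lean`; re-export the `ℤ^d` sites of `B7Prop1Explicit`.
export B7Prop1Explicit (Site)

variable {d : ℕ}

section Adapter

variable {𝔹 : Type*} [CStarAlgebra 𝔹] [Nontrivial 𝔹]

omit [Nontrivial 𝔹] in
/-- In `d ≥ 2` a bond with an end-point in `S` is a side of a plaquette touching `S`. [cite: Balaban1985RegularSpaces, p.77 (convention before (1.5))] -/
private theorem sideTouches_of_bondTouches₂ (hd2 : 2 ≤ d) {S : Set (Site d)} {y : Site d} {τ : Fin d}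
    (hb : BondTouches S y τ) : SideTouches S y τ := by
  haveI : Nontrivial (Fin d) := Fin.nontrivial_iff_two_le.mpr hd2
  obtain ⟨κ, hκ⟩ := exists_ne τ
  exact B8Eq140Level.sideTouches_of_bondTouches hκ hb

omit [Nontrivial 𝔹] in
/-- **LOCALITY OF THE SOURCED GAUGE PREDICATE IN THE CONFIGURATION**: configurations agreeing on the bonds with an end-point in `Ω₀` satisfy `LanF146 … m` together
(the clause reads `(1∕iη) log W` through `D*` at the sites of `Ω₀` only; the top clause is about `f`). [cite: Balaban1985RegularSpaces, (1.146) p.101, p.77 (bond convention)] -/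
theorem lanF146_congr {η : ℝ} {L k m : ℕ} {Ω₀ : Set (Site d)} {Λs : ℕ → ℕ → Set (Site d)} {U₀ : Site d → Fin d → 𝔹ˣ} {f : Site d → 𝔹}
    {W W' : Site d → Fin d → 𝔹ˣ} (h : ∀ (x : Site d) (μ : Fin d), BondTouches Ω₀ x μ → W x μ = W' x μ) :
    LanF146 L k η Ω₀ Λs U₀ f m W ↔ LanF146 L k η Ω₀ Λs U₀ f m W' := by
  have hind : Ω₀.indicator (covDivB η U₀ (logCfg η W) - f) = Ω₀.indicator (covDivB η U₀ (logCfg η W') - f) := by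
    refine Set.indicator_congr fun y hy => ?_
    have h₁ : ∀ ν : Fin d, logCfg η W' y ν = logCfg η W y ν := fun ν => (logCfg_congr η (h y ν (Or.inl hy))).symm
    have h₂ : ∀ ν : Fin d, logCfg η W' (y - e ν) ν = logCfg η W (y - e ν) ν :=
      fun ν => (logCfg_congr η (h (y - e ν) ν (Or.inr (by rwa [sub_add_cancel])))).symm
    rw [Pi.sub_apply, Pi.sub_apply, ← covDivB_congr_at η U₀ h₁ h₂]
  unfold LanF146
  rw [hind]

/-- ★ **THE SOURCED PROP.-5 STEP ⇒ THE SOCKET `SP5`'s BODY AT ONE LEVEL** — n04-b's `B8Prop5KLevelLetters.hP5_step_of_HFP` for Theorem 8's gauge condition: given the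
datum of level `m` (`U₁ = e^{iηA}` on the sides touching `Ω_j`, `A` Hermitian, `|A| ≤ c⋆(Lʲη)⁻¹`), a source `f ∈ R(U₀)` (`hf`, the top clause of `LanF146`), and a fixed point
`λ` in plain currency — Hermitian, `= 0` off `Ω₀`, (1.108) with `α₄ ≤ 1∕84`, THE MULTIPLIER FORM OF (1.146) at `m + 1` levels (`… − f`), (1.29) for `u₁·e^{iλ}` — the gauge
transformation `v := e^{iλ}` is unitary, `= 1` off `Ω₀`, reads `e^{iλ}` on every bond, obeys (1.108), and `U₁^{v⁻¹}` satisfies `LanF146 L k η Ω₀ Λs U₀ f (m + 1)` (n05-c g5's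
`lanF146_gaugeFixed_of_multiplier` at `e^{iηA}`, transported to `U₁` by `lanF146_congr`). [cite: Balaban1985RegularSpaces, Prop. 5 pp.93–94, (1.107)–(1.110) p.94, (1.86)–(1.88) p.91, Thm 8 (1.146) p.101] -/
theorem hP5_step_of_HFP_src (hd2 : 2 ≤ d) {η : ℝ} (hη : 0 < η) (L k m : ℕ) {U₀ : Site d → Fin d → 𝔹ˣ}
    (hU₀ : ∀ x κ, U₀ x κ ∈ unitaryUnits 𝔹) {cstar α₄ : ℝ} (hs₁ : α₄ ≤ 1 / 84) (hcs : cstar ≤ 1 / 12)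
    (Ω : ℕ → Set (Site d)) (Λs : ℕ → ℕ → Set (Site d)) (u₁ : Site d → 𝔹ˣ) (U₁ : Site d → Fin d → 𝔹ˣ) (A : Site d → Fin d → 𝔹)
    (f : Site d → 𝔹) (hf : InR138 L k η (Ω 0) (Λs k) U₀ f)
    (hdat : ∀ j, j ≤ m → ∀ b ∈ {b : Site d × Fin d | SideTouches (Ω j) b.1 b.2},
      U₁ b.1 b.2 = cfgExp η A b.1 b.2 ∧ IsSelfAdjoint (A b.1 b.2) ∧ ‖A b.1 b.2‖ ≤ cstar * ((L : ℝ) ^ j * η)⁻¹)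
    (hFP : ∃ lam : Site d → 𝔹, (∀ x, IsSelfAdjoint (lam x)) ∧ (∀ x, x ∉ Ω 0 → lam x = 0) ∧
      (∀ j, j ≤ m + 1 → ∀ b ∈ {b : Site d × Fin d | SideTouches (Ω j) b.1 b.2},
        ‖lam b.1‖ ≤ α₄ ∧ ((L : ℝ) ^ j * η) * ‖covDerivFwd η U₀ b.2 lam b.1‖ ≤ α₄) ∧
      (∃ μ : ℕ → Site d → 𝔹, ∀ x ∈ Ω 0,
        covLap η U₀ ((Ω 0).indicator fun y => covDivB η U₀ A y + covLap η U₀ lam y +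
          ((conjR (gaugeExp lam y)⁻¹ (covDivB η U₀ A y) - covDivB η U₀ A y) +
            (gAd (covLap η U₀ lam y) (lam y) - covLap η U₀ lam y) + ∑ μ, frakF3 η U₀ lam A y μ) - f y) x =
          QT L (m + 1) (Λs (m + 1)) U₀ μ x) ∧
      Restr129 L (m + 1) (Λs (m + 1)) U₀ (u₁ * gaugeExp lam)) :
    ∃ (v : Site d → 𝔹ˣ) (lam : Site d → 𝔹), (∀ x, v x ∈ unitaryUnits 𝔹) ∧ (∀ x, x ∉ Ω 0 → v x = 1) ∧
      (∀ j, j ≤ m + 1 → ∀ b ∈ {b : Site d × Fin d | SideTouches (Ω j) b.1 b.2}, (v b.1 : 𝔹) = ((gaugeExp lam b.1 : 𝔹ˣ) : 𝔹) ∧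
        (v (b.1 + e b.2) : 𝔹) = ((gaugeExp lam (b.1 + e b.2) : 𝔹ˣ) : 𝔹)) ∧
      (∀ j, j ≤ m + 1 → ∀ b ∈ {b : Site d × Fin d | SideTouches (Ω j) b.1 b.2},
        ‖lam b.1‖ ≤ α₄ ∧ ((L : ℝ) ^ j * η) * ‖covDerivFwd η U₀ b.2 lam b.1‖ ≤ α₄) ∧
      LanF146 L k η (Ω 0) Λs U₀ f (m + 1) (mgauge U₀ v⁻¹ U₁) ∧ Restr129 L (m + 1) (Λs (m + 1)) U₀ (u₁ * v) := by
  obtain ⟨lam, hsa, hoff, h108, hmult, h129⟩ := hFP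
  have hE0 : ∀ {y : Site d} {τ : Fin d}, BondTouches (Ω 0) y τ → (y, τ) ∈ {b : Site d × Fin d | SideTouches (Ω 0) b.1 b.2} :=
    fun hb => sideTouches_of_bondTouches₂ hd2 hb
  have hα12 : α₄ ≤ 1 / 12 := hs₁.trans (by norm_num)
  have hα70 : α₄ ≤ 1 / 70 := hs₁.trans (by norm_num)
  have hd1 : 0 < d := by omega
  -- (1.108) at level `j = 0` on the bonds touching `Ω₀`
  have h0 : ∀ y τ, BondTouches (Ω 0) y τ → ‖lam y‖ ≤ α₄ ∧ η * ‖covDerivFwd η U₀ τ lam y‖ ≤ α₄ := fun y τ hb => by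
    simpa only [pow_zero, one_mul] using h108 0 (Nat.zero_le _) (y, τ) (hE0 hb)
  have hl : ∀ x ∈ Ω 0, ‖lam x‖ ≤ 1 / 12 := fun x hx => (h0 x ⟨0, hd1⟩ (Or.inl hx)).1.trans hα12
  have hD : ∀ x ∈ Ω 0, ∀ μ, η * ‖covDerivFwd η U₀ μ lam x‖ ≤ 1 / 70 := fun x hx μ => (h0 x μ (Or.inl hx)).2.trans hα70
  have hback : ∀ x ∈ Ω 0, ∀ μ : Fin d, BondTouches (Ω 0) (x - e μ) μ := fun x hx μ => Or.inr (by rwa [sub_add_cancel])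
  have ha : ∀ x ∈ Ω 0, ∀ μ, η * ‖covDeriv η U₀ μ lam x‖ ≤ 1 / 70 := fun x hx μ => by
    rw [B8Eq151V2Divergence.norm_covDeriv_eq (unitaryUnits_le_U1 (hU₀ _ _)) lam]
    exact (h0 _ μ (hback x hx μ)).2.trans hα70
  have hY : ∀ x ∈ Ω 0, ∀ μ, η * ‖conjR (U₀ (x - e μ) μ)⁻¹ (A (x - e μ) μ)‖ ≤ 1 / 12 := fun x hx μ => by
    obtain ⟨-, -, hA⟩ := hdat 0 (Nat.zero_le _) (x - e μ, μ) (hE0 (hback x hx μ))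
    rw [B8Ineq132.norm_conjR ((U1 𝔹).inv_mem (unitaryUnits_le_U1 (hU₀ _ _)))]
    rw [pow_zero, one_mul] at hA
    calc η * ‖A (x - e μ) μ‖ ≤ η * (cstar * η⁻¹) := mul_le_mul_of_nonneg_left hA hη.le
      _ = cstar := by rw [mul_left_comm, mul_inv_cancel₀ hη.ne', mul_one]
      _ ≤ 1 / 12 := hcs
  have hLan : LanF146 L k η (Ω 0) Λs U₀ f (m + 1) (mgauge U₀ (gaugeExp lam)⁻¹ (cfgExp η A)) :=
    lanF146_gaugeFixed_of_multiplier hη L k (m + 1) (Ω 0) Λs U₀ A f hf hl hD ha hY hmult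
  have hcongr : ∀ (x : Site d) (μ : Fin d), BondTouches (Ω 0) x μ →
      mgauge U₀ (gaugeExp lam)⁻¹ U₁ x μ = mgauge U₀ (gaugeExp lam)⁻¹ (cfgExp η A) x μ := fun x μ hb => by
    rw [mgauge_apply, mgauge_apply, (hdat 0 (Nat.zero_le _) (x, μ) (hE0 hb)).1]
  refine ⟨gaugeExp lam, lam, fun x => ?_, fun x hx => ?_, fun j _ b _ => ⟨rfl, rfl⟩, h108, (lanF146_congr hcongr).mpr hLan, h129⟩
  · exact mem_unitaryUnits.mpr (B8Ineq170.exp_I_smul_mem_unitary (hsa x))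
  · exact Units.ext (by rw [gaugeExp, hoff x hx, smul_zero, val_expUnit, NormedSpace.exp_zero, Units.val_one])

/-- ★ **THE SOURCED SOCKET `SP5`'s LEVEL CLAUSE FROM THE SOURCED FIXED POINT IN PLAIN CURRENCY, every level `1 ≤ m < k`** — n04-b's `hP5_of_HFP` for Theorem 8's
gauge condition: the input is the ∃λ-body of `B8SockHFPRDSrc.sockHFP_body_of_join_RD_src` at every level-`m` datum in the predicate `LanF146 … m`, the output the
`∀ m`-clause of `SP5` at `LanF := LanF146 L k η Ω₀ Λs U₀ f`. [cite: Balaban1985RegularSpaces, Prop. 5 pp.93–94, (1.106)–(1.110) p.94, Thm 8 (1.146) p.101] -/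
theorem hP5_of_HFP_src (hd2 : 2 ≤ d) {η : ℝ} (hη : 0 < η) (L k : ℕ) {U₀ U' : Site d → Fin d → 𝔹ˣ}
    (hU₀ : ∀ x κ, U₀ x κ ∈ unitaryUnits 𝔹) {cstar α₄ : ℝ} (hs₁ : α₄ ≤ 1 / 84) (hcs : cstar ≤ 1 / 12)
    (Ω : ℕ → Set (Site d)) (Λs : ℕ → ℕ → Set (Site d)) (f : Site d → 𝔹) (hf : InR138 L k η (Ω 0) (Λs k) U₀ f)
    (HFP : ∀ m, 1 ≤ m → m < k → ∀ (u₁ : Site d → 𝔹ˣ) (U₁ : Site d → Fin d → 𝔹ˣ) (A : Site d → Fin d → 𝔹),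
      (∀ x, u₁ x ∈ unitaryUnits 𝔹) → (∀ x, x ∉ Ω 0 → u₁ x = 1) → mgauge U₀ u₁ U₁ = U' → Restr129 L m (Λs m) U₀ u₁ →
      LanF146 L k η (Ω 0) Λs U₀ f m U₁ →
      (∀ j, j ≤ m → ∀ b ∈ {b : Site d × Fin d | SideTouches (Ω j) b.1 b.2},
        U₁ b.1 b.2 = cfgExp η A b.1 b.2 ∧ IsSelfAdjoint (A b.1 b.2) ∧ ‖A b.1 b.2‖ ≤ cstar * ((L : ℝ) ^ j * η)⁻¹) →
      ∃ lam : Site d → 𝔹, (∀ x, IsSelfAdjoint (lam x)) ∧ (∀ x, x ∉ Ω 0 → lam x = 0) ∧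
        (∀ j, j ≤ m + 1 → ∀ b ∈ {b : Site d × Fin d | SideTouches (Ω j) b.1 b.2},
          ‖lam b.1‖ ≤ α₄ ∧ ((L : ℝ) ^ j * η) * ‖covDerivFwd η U₀ b.2 lam b.1‖ ≤ α₄) ∧
        (∃ μ : ℕ → Site d → 𝔹, ∀ x ∈ Ω 0,
          covLap η U₀ ((Ω 0).indicator fun y => covDivB η U₀ A y + covLap η U₀ lam y +
            ((conjR (gaugeExp lam y)⁻¹ (covDivB η U₀ A y) - covDivB η U₀ A y) +
              (gAd (covLap η U₀ lam y) (lam y) - covLap η U₀ lam y) + ∑ μ, frakF3 η U₀ lam A y μ) - f y) x =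
            QT L (m + 1) (Λs (m + 1)) U₀ μ x) ∧
        Restr129 L (m + 1) (Λs (m + 1)) U₀ (u₁ * gaugeExp lam)) :
    ∀ m, 1 ≤ m → m < k → ∀ (u₁ : Site d → 𝔹ˣ) (U₁ : Site d → Fin d → 𝔹ˣ) (A : Site d → Fin d → 𝔹),
      (∀ x, u₁ x ∈ unitaryUnits 𝔹) → (∀ x, x ∉ Ω 0 → u₁ x = 1) → mgauge U₀ u₁ U₁ = U' → Restr129 L m (Λs m) U₀ u₁ →
      LanF146 L k η (Ω 0) Λs U₀ f m U₁ →
      (∀ j, j ≤ m → ∀ b ∈ {b : Site d × Fin d | SideTouches (Ω j) b.1 b.2},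
        U₁ b.1 b.2 = cfgExp η A b.1 b.2 ∧ IsSelfAdjoint (A b.1 b.2) ∧ ‖A b.1 b.2‖ ≤ cstar * ((L : ℝ) ^ j * η)⁻¹) →
      ∃ (v : Site d → 𝔹ˣ) (lam : Site d → 𝔹), (∀ x, v x ∈ unitaryUnits 𝔹) ∧ (∀ x, x ∉ Ω 0 → v x = 1) ∧
        (∀ j, j ≤ m + 1 → ∀ b ∈ {b : Site d × Fin d | SideTouches (Ω j) b.1 b.2}, (v b.1 : 𝔹) = ((gaugeExp lam b.1 : 𝔹ˣ) : 𝔹) ∧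
          (v (b.1 + e b.2) : 𝔹) = ((gaugeExp lam (b.1 + e b.2) : 𝔹ˣ) : 𝔹)) ∧
        (∀ j, j ≤ m + 1 → ∀ b ∈ {b : Site d × Fin d | SideTouches (Ω j) b.1 b.2},
          ‖lam b.1‖ ≤ α₄ ∧ ((L : ℝ) ^ j * η) * ‖covDerivFwd η U₀ b.2 lam b.1‖ ≤ α₄) ∧
        LanF146 L k η (Ω 0) Λs U₀ f (m + 1) (mgauge U₀ v⁻¹ U₁) ∧ Restr129 L (m + 1) (Λs (m + 1)) U₀ (u₁ * v) :=
  fun m hm hmk u₁ U₁ A hu₁ hsupp hfix h129 hLan hdat =>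
    hP5_step_of_HFP_src hd2 hη L k m hU₀ hs₁ hcs Ω Λs u₁ U₁ A f hf hdat (HFP m hm hmk u₁ U₁ A hu₁ hsupp hfix h129 hLan hdat)

end Adapter

end Literature.MathematicalPhysics.QuantumFieldTheory.Balaban1983to89.B8SockSP5OfLettersSrc

end
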